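import Literature.MathematicalPhysics.QuantumFieldTheory.Balaban1983to89.Node00.Record11

/-!
# NODE 00 — THE START-GENERIC SLOT RECURSION OF RECORD AND THE DRESSED SLOT FAMILY: def-T's FILE 1 recursion `texpAOfRecord` with its level-0 start made a
# PARAMETER (`texpAOfRecordFrom`), the DRESSED START `e^{t·F_K}·e^{−A∕g₀(K)²}` of a datum's Wilson scheme (its integral IS the scheme's dressed partition
# function `T4GenFunBounds.schemeZ … t`, `rfl`), and the DRESSED (2.18) slot family ∕ densities ∕ class weights of a Stage-11 tuple started at a datum —
# the one `Node00/` object a contentful spine-carrier reading of N19 ∕ N20 ∕ N21 ∕ N27x reads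

Cell `pub-ymgap`, YM-PLAN Track A (HUMAN RULING D-0062); author seat `pub-ymgap-dag-n20-e` ((T-SPINE) owner) on dag-lead's OPEN WORD (a) (pub-ymgap INBOX
l.≈12580, 2026-08-26: «the n20 lineage files `Node00/DressedSlotsOfRecord.lean` itself») and node00-def-RR-2's second read (READ-OK, venue GO, sharpenings
(s1) «the start reads the DATUM, the tuple supplies the STEPS», (s2) «integrability displayed where used, never buried» — both adopted).  [III] =
[Balaban1988Convergent], [IV] = [Balaban1989LargeFieldI].

WHY.  NODE 00's Stage-11 record pins the (2.18) expansion of the UNDRESSED densities: `rhoOfRecord9 … p g k = densityOfRepr … = Σ_{s : SeqOfRecord} χ_k(s)·slot_k(s)`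
with `slotsOfRecord = texpAOfRecord E w rstepSlotOfRecord`, whose level 0 is HARD-WIRED to `ρ₀ = rhoZeroOfRecord` (`texpAOfRecord_zero`).  The K5 spine
nodes of route `BalabanUVNodes` (N19 NE7 ∕ N20 NE7b ∕ N21 NE7c ∕ the extraction stub N27x) quantify over the term-class expansion of the DRESSED two-run
partition functions `T4GenFunBounds.schemeZ (D.scheme g₀) os (K₀ + K) t` — the same 𝐑𝐓 steps run from the DRESSED start `U ↦ e^{t·F_K(os)(U)}·e^{−A(U)∕g₀(K)²}`
(the loop observables inserted at level 0 and carried through the renormalization steps; [King1986] (3.10) p. 656's dressed partition functions).  This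
file supplies exactly that object over the record's OWN sequence index, so that the E1∕E2 dictionary of `YMDAG.UVSplit.S_N27x` has a `Node00/` reading.

WHAT IS DEFINED ∕ PROVED (definitions of record + kernel bookkeeping; every face `rfl` or def-T's three-line `eval_zero`).
* §1 `texpAOfRecordFrom ν M start w R` — FILE 1's `Nat.rec` with `start : (p : RunParams) → (ℕ → ℝ) → Density (F.P p.K) 0 (SU N)` in place of `ρ₀`;
  `texpAOfRecordFrom_rhoZero : … (fun p g => rhoZeroOfRecord F N p.K (g 0) (E p)) … = texpAOfRecord F N ν M E w R` (`rfl`: NO law of FILE 1 is moved);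
  `_zero` ∕ `_succ` (`rfl`); `densityOfRepr_texpAOfRecordFrom_zero` (the assembled density at step 0 IS the start: one term, `χ_0 ≡ 1`).
* §2 `dressedStart D g₀ os t p` and **`integral_dressedStart : ∫ dressedStart … ∂fieldMeasure (F.P p.K) 0 (SU N) = schemeZ (D.scheme g₀) os p.K t`** (`rfl` —
  the E1 left side ON THE NOSE, no constant); `dressedStart_pos`; `integrable_dressedStart` (under `D.AvgMeasurable`) ∕
  `integrable_dressedStart_datumOfRecord₁₁` (NO hypothesis at a Stage-11 datum); `rhoZeroOfRecord_eq_mul_dressedStart_zero` (at `t = 0` the record's `ρ₀` is `e^{−E}` times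
  the dressed start — the sanity face tying the new start to the old).
* §3 `dressedSlotsOfDatum₁₁ θ D g₀ os t` (θ supplies the STEPS — its step weights `wOfRecord₉`, its R-slot operation `rstepSlotOfRecord` —, `D` the START),
  `dressedSlotsOfRecord₁₁ θ hP := dressedSlotsOfDatum₁₁ θ (datumOfRecord₁₁ F N θ hP)`; the dressed densities `dressedDensityOfDatum₁₁ ∕ OfRecord₁₁`
  (`densityOfRepr` of the dressed slots: the (2.18) assembly over `SeqOfRecord`); **`integral_dressedDensityOfDatum₁₁_zero : ∫ dressedDensityOfDatum₁₁ … 0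
  = schemeZ (D.scheme g₀) os p.K t`** (E1 AT LEVEL 0, proved); the class weights `classWeightOfDatum₁₁ ∕ OfRecord₁₁ … s := ∫ χ_k(s)·slot^{t,os}_k(s) dV_k`
  (run A's `S.A K t s` of a spine reading at `p = ⟨K₀+K, F.m, g₀ (K₀+K)⟩`, `k = K₀+K`); `sum_classWeightOfDatum₁₁_eq_integral` ((e1) under DISPLAYED
  integrability) and **`sum_classWeightOfRecord₁₁_zero`** (E1 at level 0 as a SUM identity at the record, NO hypothesis).

HONEST FRAMING — what this is NOT.
* OBJECTS and `rfl`-grade faces only.  E1 BEYOND LEVEL 0 is NOT proved here; it needs (e1) `Σ_s classWeight = ∫ dressedDensity_k` (finite sum ↔ integral: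
  INTEGRABILITY of the dressed pieces — to be DISPLAYED as a hypothesis where used, per (s2); at level 0 it is integrability of `e^{t·F}·boltzmann` on a
  compact group) and (e2) the (0.4) telescoping `∫ dressedDensity_{k+1} = ∫ dressedDensity_k` of def-T's T-step and def-R's R-step ON THE DRESSED FAMILY
  (the R-step lemma `integral_densityOfSlice_rstepSlotOfRecord_of_provisosSupp` is family-generic under that family's own `ProvisosSupp`; the T-step's
  `TStepProvisos.intPiece` is stated at the undressed family — its dressed twin is a definer follow-up).  Run B's partial summation into run A's classes
  (node U5d: `SeqOfRecord` at cutoff `K+1`, length `k+1` → cutoff `K`, length `k`, with the site-type transport) is NOT here.  No bad set, no shell split, no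
  weight slot is defined here (they are the READING's, Summits-side: `YMDAG.UVSplit.SpineReading₁₁`, p454411).
* Nothing of Bałaban's is asserted: [III] Thms 1–2, (2.19)–(2.44), [IV] (1.1)–(1.2), NE7∕NE7b∕NE7c (NOT PRINTED for d = 4) are neither stated nor used; no
  node count moves (typed 28∕28 · discharged 5∕28); `--supports` K0 `Record11Inhabited` (stmt-QuantumFields-19673) as a NODE 00 object module.
* No `sorry`, no `axiom`, no `opaque`, no `instance`, no `notation`, no attribute removed.  One finite four-torus programme at fixed `ε` — NOT the continuum
  limit on ℝ⁴, NOT infinite volume, NOT OS, NOT a mass gap, NOT the Clay problem.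
-/

noncomputable section

open MeasureTheory

namespace Literature.MathematicalPhysics.QuantumFieldTheory.Balaban1983to89.Node00

open T4Continuum

variable (F : T4Family) (N : ℕ) [NeZero N]

/-! ## §1 The start-generic slot recursion -/

/-- **THE SLOT RECURSION OF RECORD FROM AN ARBITRARY START**: level 0 = `start p g` on every (length-0) sequence, level k+1 = the slot operation `R` applied to
def-T's T-step (†) of level k — FILE 1's `texpAOfRecord` with its start `ρ₀` made a parameter. [cite: Balaban1988Convergent, (2.18) p.257, (3.24) p.270 (bookkeeping)] -/
def texpAOfRecordFrom (ν : Stage7Numerics) (M : ℕ) (start : (p : B12.RunParams) → (ℕ → ℝ) → Density (F.P p.K) 0 (SU N))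
    (w : StepWeightsOfRecord F N ν M) (R : SliceOpOfRecord F N ν M) : TexpAOfRecord F N ν M :=
  fun p g k => Nat.rec (motive := fun k => SeqOfRecord F ν M g p.K k → Density (F.P p.K) k (SU N))
    (fun _ => start p g) (fun k T => R p g (k + 1) (tstepOfRecord F N ν M w p g k T)) k

/-- **NO LAW MOVED**: at the undressed start `ρ₀ = rhoZeroOfRecord` the start-generic family IS FILE 1's `texpAOfRecord` (`rfl`).
[cite: Balaban1988Convergent, Thm 1 p.262 (bookkeeping)] -/
theorem texpAOfRecordFrom_rhoZero (ν : Stage7Numerics) (M : ℕ) (E : B12.RunParams → ℝ) (w : StepWeightsOfRecord F N ν M)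
    (R : SliceOpOfRecord F N ν M) :
    texpAOfRecordFrom F N ν M (fun p g => rhoZeroOfRecord F N p.K (g 0) (E p)) w R = texpAOfRecord F N ν M E w R := rfl

/-- Level 0 of the start-generic family is the start on every (length-0) sequence (`rfl`). [cite: Balaban1988Convergent, (2.18) p.257 (bookkeeping)] -/
theorem texpAOfRecordFrom_zero (ν : Stage7Numerics) (M : ℕ) (start : (p : B12.RunParams) → (ℕ → ℝ) → Density (F.P p.K) 0 (SU N))
    (w : StepWeightsOfRecord F N ν M) (R : SliceOpOfRecord F N ν M) (p : B12.RunParams) (g : ℕ → ℝ) (s : SeqOfRecord F ν M g p.K 0) :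
    texpAOfRecordFrom F N ν M start w R p g 0 s = start p g := rfl

/-- Level k+1 of the start-generic family is the slot operation of the T-step of level k (`rfl`). [cite: Balaban1989LargeFieldI, (0.3) p.176 (bookkeeping)] -/
theorem texpAOfRecordFrom_succ (ν : Stage7Numerics) (M : ℕ) (start : (p : B12.RunParams) → (ℕ → ℝ) → Density (F.P p.K) 0 (SU N))
    (w : StepWeightsOfRecord F N ν M) (R : SliceOpOfRecord F N ν M) (p : B12.RunParams) (g : ℕ → ℝ) (k : ℕ) :
    texpAOfRecordFrom F N ν M start w R p g (k + 1) =
      R p g (k + 1) (tstepOfRecord F N ν M w p g k (texpAOfRecordFrom F N ν M start w R p g k)) := rfl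

/-- **`eval_zero` FOR THE START-GENERIC FAMILY**: the (2.18)-assembled density at step 0 IS the start (one term, `χ_0 ≡ 1` — def-T's
`densityOfRepr_texpAOfRecord_zero`, proof verbatim). [cite: Balaban1988Convergent, (2.18) p.257, Thm 1 p.262 (bookkeeping)] -/
theorem densityOfRepr_texpAOfRecordFrom_zero (ν : Stage7Numerics) (M : ℕ)
    (start : (p : B12.RunParams) → (ℕ → ℝ) → Density (F.P p.K) 0 (SU N)) (w : StepWeightsOfRecord F N ν M) (R : SliceOpOfRecord F N ν M)
    (p : B12.RunParams) (g : ℕ → ℝ) :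
    densityOfRepr F N ν M (texpAOfRecordFrom F N ν M start w R) p g 0 = start p g := by
  funext V
  rw [densityOfRepr]
  simp only [B14.Eq218Concrete.Seq.sum_seq_zero, chiSeqOfRecord_zero, one_mul]
  rfl

/-! ## §2 The dressed start of a datum's Wilson scheme -/

/-- **THE DRESSED START** of the Wilson scheme `D.scheme g₀` of a datum `D` at the tuned bare sequence `g₀`, loop string `os` and source `t`, on the torus of
the run `p` (`K = p.K`): `U ↦ e^{t·F_K(U)}·e^{−A(U)∕g₀(K)²}` with `F_K = Π_{o ∈ os} obs_K(o)` (`T4GenFunBounds.prodObs`) and the Wilson–Boltzmann weight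
`Missing.boltzmann` at `β_K = g₀(K)⁻²` — the integrand of the scheme's dressed partition function. [cite: King1986, (3.10) p.656 (dressed partition functions; bookkeeping)] -/
def dressedStart (D : FiniteEpsData F (SU N)) (g₀ : ℕ → ℝ) (os : List (ULoop F)) (t : ℝ) (p : B12.RunParams) :
    Density (F.P p.K) 0 (SU N) :=
  fun U => Real.exp (t * T4GenFunBounds.prodObs (D.scheme g₀) p.K os U) * Missing.boltzmann (F.P p.K) ((g₀ p.K)⁻¹ ^ 2) U

/-- **ITS INTEGRAL IS THE SCHEME's DRESSED PARTITION FUNCTION** `schemeZ (D.scheme g₀) os p.K t` — by `rfl` (`schemeZ … K t := dressedZ (P K) (β K) F_K t :=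
∫ e^{t·F_K}·boltzmann`; `(D.scheme g₀).β K = (g₀ K)⁻¹ ^ 2`).  The left side of `S_N27x`'s E1 at level 0, on the nose. [cite: King1986, (3.10) p.656 (bookkeeping)] -/
theorem integral_dressedStart (D : FiniteEpsData F (SU N)) (g₀ : ℕ → ℝ) (os : List (ULoop F)) (t : ℝ) (p : B12.RunParams) :
    ∫ U, dressedStart F N D g₀ os t p U ∂fieldMeasure (F.P p.K) 0 (SU N) = T4GenFunBounds.schemeZ (D.scheme g₀) os p.K t := rfl

/-- The dressed start is positive pointwise (`exp > 0`, `Missing.boltzmann_pos`): the integrand of [King1986] (3.10)'s dressed partition function is a positive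
weight. [cite: King1986, (3.10) p.656 (bookkeeping)] -/
theorem dressedStart_pos (D : FiniteEpsData F (SU N)) (g₀ : ℕ → ℝ) (os : List (ULoop F)) (t : ℝ) (p : B12.RunParams)
    (U : GaugeField (F.P p.K) 0 (SU N)) : 0 < dressedStart F N D g₀ os t p U :=
  mul_pos (Real.exp_pos _) (Missing.boltzmann_pos _ _ _)

/-- **THE DRESSED START IS INTEGRABLE** when the datum's averaging maps are measurable (`D.AvgMeasurable` — true of printed-averaged data, hence of every
Stage-11 datum of record): `e^{t·F_K}` is measurable and bounded by `e^{|t|}` (`|F_K| ≤ 1`), the Wilson–Boltzmann weight is integrable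
(`Missing.integrable_boltzmann`).  The level-0 instance of the integrability that (e1) displays. [cite: King1986, (3.10) p.656 (bookkeeping)] -/
theorem integrable_dressedStart (D : FiniteEpsData F (SU N)) (hM : D.AvgMeasurable) (g₀ : ℕ → ℝ) (os : List (ULoop F)) (t : ℝ)
    (p : B12.RunParams) : Integrable (dressedStart F N D g₀ os t p) (fieldMeasure (F.P p.K) 0 (SU N)) := by
  have hF : Measurable (T4GenFunBounds.prodObs (D.scheme g₀) p.K os) :=
    T4GenFunBounds.measurable_prodObs (D.scheme g₀) (fun K o => D.measurable_avgObs hM K o) p.K os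
  have hB : ∀ U, |T4GenFunBounds.prodObs (D.scheme g₀) p.K os U| ≤ 1 :=
    T4GenFunBounds.abs_prodObs_le_one (D.scheme g₀) (fun K o U => D.abs_avgObs_le_one K o U) p.K os
  have hbd : ∀ᵐ U ∂fieldMeasure (F.P p.K) 0 (SU N), ‖Real.exp (t * T4GenFunBounds.prodObs (D.scheme g₀) p.K os U)‖ ≤ Real.exp |t| :=
    Filter.Eventually.of_forall fun U => by
      rw [Real.norm_eq_abs, abs_of_pos (Real.exp_pos _)]
      refine Real.exp_le_exp.mpr ?_
      calc t * T4GenFunBounds.prodObs (D.scheme g₀) p.K os U ≤ |t * T4GenFunBounds.prodObs (D.scheme g₀) p.K os U| := le_abs_self _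
        _ = |t| * |T4GenFunBounds.prodObs (D.scheme g₀) p.K os U| := abs_mul _ _
        _ ≤ |t| * 1 := mul_le_mul_of_nonneg_left (hB U) (abs_nonneg _)
        _ = |t| := mul_one _
  show Integrable (fun U => Real.exp (t * T4GenFunBounds.prodObs (D.scheme g₀) p.K os U) * Missing.boltzmann (F.P p.K) ((g₀ p.K)⁻¹ ^ 2) U) _
  exact (Missing.integrable_boltzmann RegularGaugeGroup.measurable_reTr (F.P p.K) (sq_nonneg _)).bdd_mul
    (Real.measurable_exp.comp (hF.const_mul t)).aestronglyMeasurable hbd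

/-- … in particular at every Stage-11 datum of record, with NO hypothesis (B1: `isPrintedAveraged_datumOfRecord₁₁` ⇒ `AvgMeasurable`).
[cite: Balaban1989LargeFieldII, Thm 1 p.355 (bookkeeping)] -/
theorem integrable_dressedStart_datumOfRecord₁₁ (θ : Stage11Params F N) (hP : θ.Provisos₁₁) (g₀ : ℕ → ℝ) (os : List (ULoop F)) (t : ℝ)
    (p : B12.RunParams) :
    Integrable (dressedStart F N (datumOfRecord₁₁ F N θ hP) g₀ os t p) (fieldMeasure (F.P p.K) 0 (SU N)) :=
  integrable_dressedStart F N _ (isPrintedAveraged_datumOfRecord₁₁ F N θ hP).avgMeasurable g₀ os t p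

/-- **SANITY FACE — the old start inside the new**: at source `t = 0` and bare coupling `g₀ (p.K)`, the record's undressed start `ρ₀ = rhoZeroOfRecord … (g₀ p.K) E`
is `e^{−E}` times the dressed start (the constant [III] Thm 1 p. 262 normalises `ρ₀` by). [cite: Balaban1988Convergent, Thm 1 p.262 (bookkeeping)] -/
theorem rhoZeroOfRecord_eq_mul_dressedStart_zero (D : FiniteEpsData F (SU N)) (g₀ : ℕ → ℝ) (os : List (ULoop F)) (p : B12.RunParams) (E : ℝ)
    (U : GaugeField (F.P p.K) 0 (SU N)) :
    rhoZeroOfRecord F N p.K (g₀ p.K) E U = Real.exp (-E) * dressedStart F N D g₀ os 0 p U := by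
  simp only [rhoZeroOfRecord, dressedStart, zero_mul, Real.exp_zero, one_mul]

/-! ## §3 The dressed slot family, densities and class weights of a Stage-11 tuple started at a datum -/

/-- **THE DRESSED SLOT FAMILY of the Stage-11 tuple `θ` STARTED AT THE DATUM `D`** (sharpening (s1): θ supplies the STEPS — its step weights `wOfRecord₉` and its
R-slot operation `rstepSlotOfRecord` —, `D` supplies the START): the start-generic recursion from the dressed start of `D`'s Wilson scheme.  At the key of record
(`D = datumOfRecord₁₁ F N h.params h.provisos`, `Node00.Record11DatumKey`) the `S_N27x` clauses read `schemeZ (D.scheme g₀)` literally.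
[cite: Balaban1988Convergent, (2.18) p.257, (3.24)–(3.25) p.270; Balaban1989LargeFieldI, (0.3) p.176 (bookkeeping)] -/
def dressedSlotsOfDatum₁₁ (θ : Stage11Params F N) (D : FiniteEpsData F (SU N)) (g₀ : ℕ → ℝ) (os : List (ULoop F)) (t : ℝ) :
    TexpAOfRecord F N θ.ν θ.τ9.M :=
  texpAOfRecordFrom F N θ.ν θ.τ9.M (fun p _ => dressedStart F N D g₀ os t p) (wOfRecord₉ F N θ.toStage9Params)
    (rstepSlotOfRecord F N θ.ν θ.τ9 θ.ppSel)

/-- Level 0 of the dressed slots IS the dressed start, on every length-0 sequence (`rfl`). [cite: Balaban1988Convergent, (2.18) p.257 (bookkeeping)] -/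
theorem dressedSlotsOfDatum₁₁_zero (θ : Stage11Params F N) (D : FiniteEpsData F (SU N)) (g₀ : ℕ → ℝ) (os : List (ULoop F)) (t : ℝ)
    (p : B12.RunParams) (g : ℕ → ℝ) (s : SeqOfRecord F θ.ν θ.τ9.M g p.K 0) :
    dressedSlotsOfDatum₁₁ F N θ D g₀ os t p g 0 s = dressedStart F N D g₀ os t p := rfl

/-- **THE DRESSED SLOT FAMILY OF RECORD** of an admissible-with-provisos tuple: the datum-started family AT ITS OWN DATUM `datumOfRecord₁₁ F N θ hP`.
[cite: Balaban1988Convergent, (2.18) p.257; Balaban1989LargeFieldII, Thm 1 + (0.1) pp.355–356 (bookkeeping)] -/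
def dressedSlotsOfRecord₁₁ (θ : Stage11Params F N) (hP : θ.Provisos₁₁) (g₀ : ℕ → ℝ) (os : List (ULoop F)) (t : ℝ) :
    TexpAOfRecord F N θ.ν θ.τ9.M :=
  dressedSlotsOfDatum₁₁ F N θ (datumOfRecord₁₁ F N θ hP) g₀ os t

/-- Face (`rfl`): the record's dressed slots are the datum-started ones at its own datum. [cite: Balaban1989LargeFieldII, Thm 1 p.355 (bookkeeping)] -/
theorem dressedSlotsOfRecord₁₁_eq (θ : Stage11Params F N) (hP : θ.Provisos₁₁) (g₀ : ℕ → ℝ) (os : List (ULoop F)) (t : ℝ) :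
    dressedSlotsOfRecord₁₁ F N θ hP g₀ os t = dressedSlotsOfDatum₁₁ F N θ (datumOfRecord₁₁ F N θ hP) g₀ os t := rfl

/-- **THE DRESSED DENSITIES** after `k` steps: the (2.18) assembly `Σ_{s : SeqOfRecord} χ_k(s)·slot^{t,os}_k(s)` of the dressed slots over the record's OWN sequence
index (`densityOfRepr`). [cite: Balaban1988Convergent, (2.18) p.257 (bookkeeping)] -/
def dressedDensityOfDatum₁₁ (θ : Stage11Params F N) (D : FiniteEpsData F (SU N)) (g₀ : ℕ → ℝ) (os : List (ULoop F)) (t : ℝ)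
    (p : B12.RunParams) (g : ℕ → ℝ) (k : ℕ) : Density (F.P p.K) k (SU N) :=
  densityOfRepr F N θ.ν θ.τ9.M (dressedSlotsOfDatum₁₁ F N θ D g₀ os t) p g k

/-- At step 0 the dressed density IS the dressed start (§1 `eval_zero`). [cite: Balaban1988Convergent, (2.18) p.257, Thm 1 p.262 (bookkeeping)] -/
theorem dressedDensityOfDatum₁₁_zero (θ : Stage11Params F N) (D : FiniteEpsData F (SU N)) (g₀ : ℕ → ℝ) (os : List (ULoop F)) (t : ℝ)
    (p : B12.RunParams) (g : ℕ → ℝ) : dressedDensityOfDatum₁₁ F N θ D g₀ os t p g 0 = dressedStart F N D g₀ os t p :=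
  densityOfRepr_texpAOfRecordFrom_zero F N θ.ν θ.τ9.M _ _ _ p g

/-- **E1 AT LEVEL 0, PROVED**: the dressed density at step 0 integrates to the scheme's dressed partition function `schemeZ (D.scheme g₀) os p.K t` — no
hypothesis. (Beyond level 0 the identity is the (0.4) telescoping of the steps on the dressed family, obligations (e1)∕(e2) of the header — NOT claimed here.)
[cite: Balaban1985UV3, (6) p.257; King1986, (3.10) p.656 (bookkeeping)] -/
theorem integral_dressedDensityOfDatum₁₁_zero (θ : Stage11Params F N) (D : FiniteEpsData F (SU N)) (g₀ : ℕ → ℝ) (os : List (ULoop F)) (t : ℝ)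
    (p : B12.RunParams) (g : ℕ → ℝ) :
    ∫ V, dressedDensityOfDatum₁₁ F N θ D g₀ os t p g 0 V ∂fieldMeasure (F.P p.K) 0 (SU N) = T4GenFunBounds.schemeZ (D.scheme g₀) os p.K t := by
  rw [dressedDensityOfDatum₁₁_zero]
  rfl

/-- The dressed densities OF RECORD (the specialisation `D := datumOfRecord₁₁ F N θ hP`). [cite: Balaban1989LargeFieldII, Thm 1 p.355 (bookkeeping)] -/
def dressedDensityOfRecord₁₁ (θ : Stage11Params F N) (hP : θ.Provisos₁₁) (g₀ : ℕ → ℝ) (os : List (ULoop F)) (t : ℝ)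
    (p : B12.RunParams) (g : ℕ → ℝ) (k : ℕ) : Density (F.P p.K) k (SU N) :=
  dressedDensityOfDatum₁₁ F N θ (datumOfRecord₁₁ F N θ hP) g₀ os t p g k

/-- **THE CLASS WEIGHT OF ONE SEQUENCE OF RECORD** at the source `t`: `∫ χ_k(s)(V)·slot^{t,os}_k(s)(V) dV_k` — run A's term weight `S.A K t s` of a spine reading
of this family at `p = ⟨K₀ + K, F.m, g₀ (K₀ + K)⟩`, `k = K₀ + K` (the reading itself — index packaging, bad sets, shells, slots — is Summits-side).
[cite: Balaban1988Convergent, (2.18) p.257; King1986, (3.10) p.656 (bookkeeping)] -/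
def classWeightOfDatum₁₁ (θ : Stage11Params F N) (D : FiniteEpsData F (SU N)) (g₀ : ℕ → ℝ) (os : List (ULoop F)) (p : B12.RunParams)
    (g : ℕ → ℝ) (k : ℕ) (t : ℝ) (s : SeqOfRecord F θ.ν θ.τ9.M g p.K k) : ℝ :=
  ∫ V, chiSeqOfRecord F N θ.ν θ.τ9.M g p.K k s V * dressedSlotsOfDatum₁₁ F N θ D g₀ os t p g k s V ∂fieldMeasure (F.P p.K) k (SU N)

/-- The class weights OF RECORD (`D := datumOfRecord₁₁ F N θ hP`). [cite: Balaban1989LargeFieldII, Thm 1 p.355 (bookkeeping)] -/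
def classWeightOfRecord₁₁ (θ : Stage11Params F N) (hP : θ.Provisos₁₁) (g₀ : ℕ → ℝ) (os : List (ULoop F)) (p : B12.RunParams)
    (g : ℕ → ℝ) (k : ℕ) (t : ℝ) (s : SeqOfRecord F θ.ν θ.τ9.M g p.K k) : ℝ :=
  classWeightOfDatum₁₁ F N θ (datumOfRecord₁₁ F N θ hP) g₀ os p g k t s

/-- **THE PIECEWISE INTEGRAND SUMS TO THE DRESSED DENSITY** (pointwise, finite sum — the integrand side of obligation (e1); the integral side needs the displayed
integrability of the pieces). [cite: Balaban1988Convergent, (2.18) p.257 (bookkeeping)] -/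
theorem sum_chi_mul_dressedSlots_eq (θ : Stage11Params F N) (D : FiniteEpsData F (SU N)) (g₀ : ℕ → ℝ) (os : List (ULoop F)) (t : ℝ)
    (p : B12.RunParams) (g : ℕ → ℝ) (k : ℕ) (V : GaugeField (F.P p.K) k (SU N)) :
    ∑ s : SeqOfRecord F θ.ν θ.τ9.M g p.K k, chiSeqOfRecord F N θ.ν θ.τ9.M g p.K k s V * dressedSlotsOfDatum₁₁ F N θ D g₀ os t p g k s V =
      dressedDensityOfDatum₁₁ F N θ D g₀ os t p g k V := rfl

/-- **(e1) UNDER DISPLAYED INTEGRABILITY**: if every piece `χ_k(s)·slot^{t,os}_k(s)` is integrable (hypothesis, per (s2)), the class weights sum to the integral of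
the dressed density at step `k`. [cite: Balaban1988Convergent, (2.18) p.257 (bookkeeping)] -/
theorem sum_classWeightOfDatum₁₁_eq_integral (θ : Stage11Params F N) (D : FiniteEpsData F (SU N)) (g₀ : ℕ → ℝ) (os : List (ULoop F)) (t : ℝ)
    (p : B12.RunParams) (g : ℕ → ℝ) (k : ℕ)
    (hint : ∀ s : SeqOfRecord F θ.ν θ.τ9.M g p.K k,
      Integrable (fun V => chiSeqOfRecord F N θ.ν θ.τ9.M g p.K k s V * dressedSlotsOfDatum₁₁ F N θ D g₀ os t p g k s V)
        (fieldMeasure (F.P p.K) k (SU N))) :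
    ∑ s : SeqOfRecord F θ.ν θ.τ9.M g p.K k, classWeightOfDatum₁₁ F N θ D g₀ os p g k t s =
      ∫ V, dressedDensityOfDatum₁₁ F N θ D g₀ os t p g k V ∂fieldMeasure (F.P p.K) k (SU N) := by
  unfold classWeightOfDatum₁₁
  rw [← integral_finsetSum Finset.univ (fun s _ => hint s)]
  rfl

/-- **E1 AT LEVEL 0 AS A SUM IDENTITY, AT THE RECORD, NO HYPOTHESIS**: at a Stage-11 datum of record the class weights of the (length-0) sequences sum to the
scheme's dressed partition function `schemeZ ((datumOfRecord₁₁ F N θ hP).scheme g₀) os p.K t` (integrability at level 0 by `integrable_dressedStart_datumOfRecord₁₁`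
and `χ_0 ≡ 1`). [cite: Balaban1985UV3, (6) p.257; King1986, (3.10) p.656 (bookkeeping)] -/
theorem sum_classWeightOfRecord₁₁_zero (θ : Stage11Params F N) (hP : θ.Provisos₁₁) (g₀ : ℕ → ℝ) (os : List (ULoop F)) (t : ℝ)
    (p : B12.RunParams) (g : ℕ → ℝ) :
    ∑ s : SeqOfRecord F θ.ν θ.τ9.M g p.K 0, classWeightOfRecord₁₁ F N θ hP g₀ os p g 0 t s =
      T4GenFunBounds.schemeZ ((datumOfRecord₁₁ F N θ hP).scheme g₀) os p.K t := by
  unfold classWeightOfRecord₁₁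
  rw [sum_classWeightOfDatum₁₁_eq_integral, integral_dressedDensityOfDatum₁₁_zero]
  intro s
  have h : (fun V => chiSeqOfRecord F N θ.ν θ.τ9.M g p.K 0 s V * dressedSlotsOfDatum₁₁ F N θ (datumOfRecord₁₁ F N θ hP) g₀ os t p g 0 s V)
      = dressedStart F N (datumOfRecord₁₁ F N θ hP) g₀ os t p := by
    funext V
    rw [chiSeqOfRecord_zero, one_mul]
    rfl
  rw [h]
  exact integrable_dressedStart_datumOfRecord₁₁ F N θ hP g₀ os t p

end Literature.MathematicalPhysics.QuantumFieldTheory.Balaban1983to89.Node00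

end
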